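import Summits.HubbardSuperconductivity.HubbardSuperconductivity.Theorems.AnisotropyChordTransferFibre3FinXDGM3Range
import Summits.HubbardSuperconductivity.HubbardSuperconductivity.Theorems.AnisotropyChordTransferFibre3FinX5GM3Range25to32
import Summits.HubbardSuperconductivity.HubbardSuperconductivity.Theorems.AnisotropyChordTransferFibre3FinX5GM3ThirtyThree
import Summits.HubbardSuperconductivity.HubbardSuperconductivity.Theorems.AnisotropyChordTransferFibre3FinX5GM3ThirtyFour

/-!
# Route `AnisotropyChord` / H0 rotor rung: ★★★★ GM₃ FOR EVERY `9 ≤ L ≤ 34` AND EVERY `0 < Δ ≤ 0.98`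

`gm3_range_9_34`: g7's `gm3_range` (`9 ≤ L ≤ 24`, per-`L` XD/XBC certificates), g8's `gm3_range_25_32` (X4/X5) and the per-`L`
X5 certificates `gm3_thirtythree`, `gm3_thirtyfour`, in one statement.  Prover seat `hubbard-h0-rotor-p3` g8; helper for piece A =
stmt-HubbardSuperconductivity-23918 of rung 19089 (`--supports`, helper class).  WHAT THIS IS NOT: nothing here proves superconductivity
in the Hubbard model (rotor TARGET as worded stays FALSE, g15 verdict); the finite-`L` GM₃ input of ONE conditional reduction, `L ≤ 34`.
-/

set_option linter.dupNamespace false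
set_option autoImplicit false

namespace Summit.HubbardSuperconductivity.HubbardSuperconductivity.Theorems.AnisotropyChord.Transfer.Fibre3

/-- ★★★★ **GM₃ for every `9 ≤ L ≤ 34`, `0 < Δ ≤ 0.98`**, kernel-certified per `L` from zero data. [folklore] -/
theorem gm3_range_9_34 (L : ℕ) [NeZero L] (hlo : 9 ≤ L) (hhi : L ≤ 34) {Δ : ℝ} (hΔ0 : 0 < Δ) (hΔ1 : Δ ≤ 0.98) :
    GM3Fibre L Δ := by
  by_cases h24 : L ≤ 24
  · exact gm3_range L hlo h24 hΔ0 hΔ1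
  by_cases h32 : L ≤ 32
  · exact gm3_range_25_32 L (by omega) h32 hΔ0 hΔ1
  have h33 : 33 ≤ L := by omega
  interval_cases L
  · exact gm3_thirtythree hΔ0 hΔ1
  · exact gm3_thirtyfour hΔ0 hΔ1

end Summit.HubbardSuperconductivity.HubbardSuperconductivity.Theorems.AnisotropyChord.Transfer.Fibre3
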